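import Summits.BirchSwinnertonDyer.BirchSwinnertonDyer.Theorems.KimAtThreeFineKatoValueEquivarianceBridge
import Summits.BirchSwinnertonDyer.BirchSwinnertonDyer.Theorems.KimAtThreeDeepLowerExpStarOmegaPlace
import Literature.NumberTheory.EllipticCurves.BSDConductorProofs
import HarnessLib

/-!
# Kato's dual-exponential value datum `Λ` DEFINED in the kernel — the single-completion semi-local
# `exp*`: `Λ_{k,r} := Ψ⁻¹ ∘ (w ↦ (g̃_w⁻¹)_* (exp*_{w₀} (loc^{tower}_{w₀} (g_w · y))))`, a `ℤ_p`-LINEAR map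
# `H¹(U, T_pW) → ℚ_p ⊗ ℚ(ζ_m)` (crux `KatoKuriharaPortThreeShared`, stmt-BirchSwinnertonDyer-19560;
# cell `bsd-addord`, seat w2-acc5 gen 6; route W2 `KimAtThreeKolyvagin`; definitions + their API)

HONEST FRAMING.  Definitions with bodies and TOOL theorems about them (no named fact, no instance, no
notation, no `sorry`).  Nothing is closed and nothing is booked; BSD is not proved by any of this.  The file
SUPPLIES AN OBJECT: the packages of record for crux 19560 — `hKatoV2₀` (kim3 g15,
`KimAtThreeFineKatoPerFactorPartsSingle`) and its descendants — quantify over an ABSTRACT value datum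
`Λ = (Λ_{k,r})`, `Λ_{k,r} : H¹(U_{k,r}, T_pW) →ₗ[ℤ_p] ℚ_p ⊗ ℚ(ζ_m)` (the `Λ` of `Kato2004.ZetaBody`), pinned to
the defined `exp*` only through the displayed clause (DEF₀) «`Ψ(Λ y)_w = (g̃_w⁻¹)_* (exp*_{w₀} [ψT])` for
every cocycle `ψT` representing `loc^{tower}_{w₀}(g_w · y)`».  With this file that `Λ` IS a definition and
(DEF₀) a theorem about it (sequel `KimAtThreeFineKatoDefinedLambda`), so the displayed residual of 19560
loses its `∃ Λ` (LEAD kim3 g15 HANDOFF «NEXT (iii)»; w2-acc5 g5 FINAL «optional road»).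

## Contents

§1 (every `p`, `k`, `r`; abstract value map).  For `m = cycLevel p k r`, `L = ℚ(ζ_m)`, `U = cycSubgroup p k r`,
a `ℚ`-algebra isomorphism `Ψ : ℚ_p ⊗ L ≃ ∏_{w ∣ p} L_w`, one place `w₀ ∣ p`, an additive
`F : H¹(U, T_pW) →+ L_{w₀}` (intended `exp*_{w₀} ∘ loc^{tower}_{w₀} ∘ H1toInt`) and a twist family
`g : {w ∣ p} → Γ_ℚ` with `g̃_w • w = w₀` (`g̃ = sigma m ∘ χ_m`):
* `semiLocalValue … y : ∏_w L_w`, `w ↦ (g̃_w⁻¹)_* (F (g_w · y))` (`galAdicCompletionMap`, Cassels–Fröhlich VII §1.1);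
* `definedLambdaHom … : H¹(U, T_pW) →+ ℚ_p ⊗ L`, `y ↦ Ψ⁻¹ (semiLocalValue y)`, with
  `apply_definedLambdaHom : Ψ (Λ y)_w = (g̃_w⁻¹)_* (F (g_w · y))` (the class-level (DEF₀));
* `definedLambdaHom_smul` — **`ℤ_p`-linearity** from the pure-tensor formula `hΨ` for `Ψ` and the
  `ℚ_v`-semilinearity `hF : F (a · Y) = e_p(a) · F Y` (`e_p = Padic.adicCompletionEquiv : ℚ_p ≃ ℚ_v`);
  `definedLambda … : H¹(U, T_pW) →ₗ[ℤ_p] ℚ_p ⊗ L` — EXACTLY the type of `ZetaBody`'s `Λ k r`.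

§2 (plumbing for the sequel, every `p`): `prime_mem_asIdeal_extension` (`p ∈ w` for `w ∣ v_p` — kim3's
`three_mem_asIdeal_extension` at every `p`), `absGaloisRestrictTower_adicCompletion_mem_cycSubgroup_prime` (the
tower of `L_w` lands in the level — kim3's level lemma at every `p`),
`algebraMap_adicCompletionPadicAlgebra_eq_algebraMap_adicCompletionEquiv` (the canonical `ℚ_p → L_w` reads `ℚ_p`
through `ℚ_{v_p}`, `e_p = Padic.adicCompletionEquiv`).

NOT here: the sequel `KimAtThreeFineKatoDefinedLambdaExpStarDefs` takes `F := exp*_{w₀} ∘ loc^{tower}_{w₀} ∘ H1toInt`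
(w2-c2 `expStarOmegaHom`), proves its `hF` (`expStarTowerMap_smul`) and defines **`katoLambda`** — Kato's
`exp* ∘ loc_p` in the Néron coordinate; `KimAtThreeFineKatoDefinedLambda` (`--supports 19560`) then proves
(DEF₀) ON COCYCLES verbatim as displayed in `hKatoV2₀`, `ZetaBody` (C3a)/(C3b) for `katoLambda`, and
`hKatoDef → hKatoV2₀`.

References: K. Kato, Astérisque 295 (2004) §9.4, Thm. 9.7 [Kato2004Asterisque]; K. Kato, LNM 1553 (1993)
Ch. II §1.2.4 [Kato1993LNM1553]; J. W. S. Cassels, A. Fröhlich (1967) Ch. II §10 (10.2), Ch. VII §1.1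
[CasselsFrohlichANT1967]; J.-P. Serre, *Local Fields* (1979) II §3 [SerreLocalFields1979]; J.-P. Serre,
*Galois Cohomology* (1997) I §2.2, §2.4 [SerreGaloisCohomology1997].
-/

noncomputable section

-- the cell's Theorems namespace `Summit.BirchSwinnertonDyer.BirchSwinnertonDyer.…` repeats the summit name by design (D-0017)
set_option linter.dupNamespace false

open scoped Classical NumberField ContRepresentation TensorProduct Pointwise
open Field ValuativeRel NumberField IsDedekindDomain
open WeierstrassCurve Literature.NumberTheory.EllipticCurves Literature.NumberTheory.GaloisRepresentations
  Literature.NumberTheory.GaloisRepresentations.DiscreteGaloisModule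
  Literature.NumberTheory.EllipticCurves.Kato2004.EulerSystemValues
open Literature.NumberTheory.GaloisRepresentations.PeriodRingData Literature.NumberTheory.PAdicHodge
open Literature.NumberTheory.AdelicBaseChange Literature.NumberTheory.Automorphic
open Summit.BirchSwinnertonDyer.Rank1Residual.GaloisImage
open Summit.BirchSwinnertonDyer.BirchSwinnertonDyer.Theorems.KimAtThreeFineKatoLevelCompat
open Summit.BirchSwinnertonDyer.BirchSwinnertonDyer.Theorems.KimAtThreeFineKatoLevelCompatDef
open Summit.BirchSwinnertonDyer.BirchSwinnertonDyer.Theorems.KimAtThreeDeepLowerExpStarOmega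
open Summit.BirchSwinnertonDyer.BirchSwinnertonDyer.Theorems.KimAtThreeDeepLowerExpStarOmegaPlace

namespace Summit.BirchSwinnertonDyer.BirchSwinnertonDyer.Theorems.KimAtThreeFineKatoDefinedLambda

/-! ### §1 The single-completion semi-local value datum for an abstract additive `F` -/

section Abstract

variable (W : WeierstrassCurve ℚ) [W.IsElliptic] (p : ℕ) [hp : Fact p.Prime]
  [ContinuousSMul ℤ_[p] (W.tateModule p)] (k : ℕ) (r : Finset (HeightOneSpectrum (𝓞 ℚ)))
  (Ψ : ℚ_[p] ⊗[ℚ] CyclotomicField (cycLevel p k r) ℚ ≃ₐ[ℚ]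
    (Π w : ((Rat.HeightOneSpectrum.primesEquiv (R := 𝓞 ℚ)).symm ⟨p, Fact.out⟩).Extension
      (𝓞 (CyclotomicField (cycLevel p k r) ℚ)), w.1.adicCompletion (CyclotomicField (cycLevel p k r) ℚ)))
  (w₀ : ((Rat.HeightOneSpectrum.primesEquiv (R := 𝓞 ℚ)).symm ⟨p, Fact.out⟩).Extension
    (𝓞 (CyclotomicField (cycLevel p k r) ℚ)))
  (F : H1 (tateRep W p) (cycSubgroup p k r) →+ w₀.1.adicCompletion (CyclotomicField (cycLevel p k r) ℚ))
  (g : ((Rat.HeightOneSpectrum.primesEquiv (R := 𝓞 ℚ)).symm ⟨p, Fact.out⟩).Extension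
    (𝓞 (CyclotomicField (cycLevel p k r) ℚ)) → absoluteGaloisGroup ℚ)
  (hg : ∀ w : ((Rat.HeightOneSpectrum.primesEquiv (R := 𝓞 ℚ)).symm ⟨p, Fact.out⟩).Extension
      (𝓞 (CyclotomicField (cycLevel p k r) ℚ)),
    sigma (cycLevel p k r) (modNCyclotomicCharacter ℚ (cycLevel p k r) (g w)) • w.1 = w₀.1)

/-- **The semi-local value vector** `(Ψ Λ y)_w := (g̃_w⁻¹)_* (F (g_w · y)) ∈ L_w`, `w ∣ p`: the value of `F`
(intended: `exp*_{w₀} ∘ loc^{tower}_{w₀}`) on the TWISTED class `g_w · y` (`conjMap`), transported from `L_{w₀}`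
to `L_w` along `g̃_w⁻¹` (`galAdicCompletionMap`, `g̃_w⁻¹ • w₀ = w`).
[cite: Kato2004Asterisque, §9.4 (p. 188)] [cite: CasselsFrohlichANT1967, Ch. VII §1.1] -/
def semiLocalValue (y : H1 (tateRep W p) (cycSubgroup p k r)) :
    Π w : ((Rat.HeightOneSpectrum.primesEquiv (R := 𝓞 ℚ)).symm ⟨p, Fact.out⟩).Extension
      (𝓞 (CyclotomicField (cycLevel p k r) ℚ)), w.1.adicCompletion (CyclotomicField (cycLevel p k r) ℚ) :=
  fun w => galAdicCompletionMap
    (sigma (cycLevel p k r) (modNCyclotomicCharacter ℚ (cycLevel p k r) (g w)))⁻¹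
    (inv_smul_eq_of_smul_eq (hg w))
    (F (conjMap (tateRep W p).toTopRep (cycSubgroup p k r) (g w) 1 y))

/-- Unfolding `semiLocalValue`. [cite: Kato2004Asterisque, §9.4 (p. 188)] -/
theorem semiLocalValue_apply (y : H1 (tateRep W p) (cycSubgroup p k r))
    (w : ((Rat.HeightOneSpectrum.primesEquiv (R := 𝓞 ℚ)).symm ⟨p, Fact.out⟩).Extension
      (𝓞 (CyclotomicField (cycLevel p k r) ℚ))) :
    semiLocalValue W p k r w₀ F g hg y w = galAdicCompletionMap
      (sigma (cycLevel p k r) (modNCyclotomicCharacter ℚ (cycLevel p k r) (g w)))⁻¹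
      (inv_smul_eq_of_smul_eq (hg w))
      (F (conjMap (tateRep W p).toTopRep (cycSubgroup p k r) (g w) 1 y)) := rfl

/-- `semiLocalValue` is additive in the class. [cite: Kato2004Asterisque, §9.4 (p. 188)] -/
theorem semiLocalValue_add (y y' : H1 (tateRep W p) (cycSubgroup p k r)) :
    semiLocalValue W p k r w₀ F g hg (y + y') =
      semiLocalValue W p k r w₀ F g hg y + semiLocalValue W p k r w₀ F g hg y' := by
  funext w
  simp only [Pi.add_apply, semiLocalValue_apply, map_add]

/-- **`Λ_{k,r}` as an additive map**: `y ↦ Ψ⁻¹ ((g̃_w⁻¹)_* (F (g_w · y)))_w` — Kato's semi-local value datum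
`exp* ∘ loc_p : H¹(U, T) → ℚ_p ⊗ ℚ(ζ_m)` read through ONE completion (`Ψ : ℚ_p ⊗ L ≅ ∏_{w ∣ p} L_w`,
Cassels–Fröhlich II §10 (10.2)). [cite: Kato2004Asterisque, §9.4 (p. 188)]
[cite: CasselsFrohlichANT1967, Ch. II §10 Theorem (10.2) and Ch. VII §1.1] -/
def definedLambdaHom :
    H1 (tateRep W p) (cycSubgroup p k r) →+ ℚ_[p] ⊗[ℚ] CyclotomicField (cycLevel p k r) ℚ where
  toFun y := Ψ.symm (semiLocalValue W p k r w₀ F g hg y)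
  map_zero' := by
    have h0 : semiLocalValue W p k r w₀ F g hg 0 = 0 := by
      funext w; simp only [Pi.zero_apply, semiLocalValue_apply, map_zero]
    rw [h0, map_zero]
  map_add' y y' := by rw [semiLocalValue_add, map_add]

/-- **(DEF₀) at class level for `definedLambdaHom`**: `Ψ (Λ y)_w = (g̃_w⁻¹)_* (F (g_w · y))` — by definition.
[cite: Kato2004Asterisque, §9.4 (p. 188)] -/
theorem apply_definedLambdaHom (y : H1 (tateRep W p) (cycSubgroup p k r))
    (w : ((Rat.HeightOneSpectrum.primesEquiv (R := 𝓞 ℚ)).symm ⟨p, Fact.out⟩).Extension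
      (𝓞 (CyclotomicField (cycLevel p k r) ℚ))) :
    Ψ (definedLambdaHom W p k r Ψ w₀ F g hg y) w = galAdicCompletionMap
      (sigma (cycLevel p k r) (modNCyclotomicCharacter ℚ (cycLevel p k r) (g w)))⁻¹
      (inv_smul_eq_of_smul_eq (hg w))
      (F (conjMap (tateRep W p).toTopRep (cycSubgroup p k r) (g w) 1 y)) := by
  change Ψ (Ψ.symm (semiLocalValue W p k r w₀ F g hg y)) w = _
  rw [AlgEquiv.apply_symm_apply, semiLocalValue_apply]

variable
  (hΨ : ∀ (s : ℚ_[p]) (x : CyclotomicField (cycLevel p k r) ℚ)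
    (w : ((Rat.HeightOneSpectrum.primesEquiv (R := 𝓞 ℚ)).symm ⟨p, Fact.out⟩).Extension
      (𝓞 (CyclotomicField (cycLevel p k r) ℚ))),
    Ψ (s ⊗ₜ[ℚ] x) w = algebraMap (CyclotomicField (cycLevel p k r) ℚ)
        (w.1.adicCompletion (CyclotomicField (cycLevel p k r) ℚ)) x *
      algebraMap (((Rat.HeightOneSpectrum.primesEquiv (R := 𝓞 ℚ)).symm ⟨p, Fact.out⟩).adicCompletion ℚ)
        (w.1.adicCompletion (CyclotomicField (cycLevel p k r) ℚ)) (Padic.adicCompletionEquiv (𝓞 ℚ) ⟨p, Fact.out⟩ s))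
  (hF : ∀ (a : ℤ_[p]) (Y : H1 (tateRep W p) (cycSubgroup p k r)),
    F (a • Y) = algebraMap (((Rat.HeightOneSpectrum.primesEquiv (R := 𝓞 ℚ)).symm ⟨p, Fact.out⟩).adicCompletion ℚ)
        (w₀.1.adicCompletion (CyclotomicField (cycLevel p k r) ℚ))
        (Padic.adicCompletionEquiv (𝓞 ℚ) ⟨p, Fact.out⟩ (a : ℚ_[p])) * F Y)

include hΨ in
/-- The pure-tensor formula makes `Ψ` semilinear for the `ℤ_p`-action on the left factor:
`Ψ (a · t)_w = e_p(a) · Ψ(t)_w` (`e_p = Padic.adicCompletionEquiv`, read in `L_w` through `ℚ_v → L_w`).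
[cite: CasselsFrohlichANT1967, Ch. II §10 Theorem (10.2)] -/
theorem map_smul_apply_of_tmul (a : ℤ_[p]) (t : ℚ_[p] ⊗[ℚ] CyclotomicField (cycLevel p k r) ℚ)
    (w : ((Rat.HeightOneSpectrum.primesEquiv (R := 𝓞 ℚ)).symm ⟨p, Fact.out⟩).Extension
      (𝓞 (CyclotomicField (cycLevel p k r) ℚ))) :
    Ψ (a • t) w = algebraMap (((Rat.HeightOneSpectrum.primesEquiv (R := 𝓞 ℚ)).symm ⟨p, Fact.out⟩).adicCompletion ℚ)
        (w.1.adicCompletion (CyclotomicField (cycLevel p k r) ℚ))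
        (Padic.adicCompletionEquiv (𝓞 ℚ) ⟨p, Fact.out⟩ (a : ℚ_[p])) * Ψ t w := by
  induction t using TensorProduct.induction_on with
  | zero => simp
  | tmul s x =>
    rw [TensorProduct.smul_tmul', hΨ, hΨ]
    have hs : a • s = (a : ℚ_[p]) * s := rfl
    rw [hs, map_mul, map_mul]
    ring
  | add t₁ t₂ h₁ h₂ => rw [smul_add, map_add, map_add, Pi.add_apply, Pi.add_apply, h₁, h₂, mul_add]

include hΨ hF in
/-- **`Λ_{k,r}` is `ℤ_p`-linear** (`conjMap` is `ℤ_p`-linear; `F` is `ℤ_p`-homogeneous through `ℚ_v → L_{w₀}`;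
the transports `(g̃_w⁻¹)_*` are `ℚ_v`-linear, `galAdicCompletionMap_algebraMap_adicCompletion`; `Ψ` is
semilinear, `map_smul_apply_of_tmul`). [cite: Kato2004Asterisque, §9.4 (p. 188)]
[cite: CasselsFrohlichANT1967, Ch. II §10 Theorem (10.2) and Ch. VII §1.1] -/
theorem definedLambdaHom_smul (a : ℤ_[p]) (y : H1 (tateRep W p) (cycSubgroup p k r)) :
    definedLambdaHom W p k r Ψ w₀ F g hg (a • y) = a • definedLambdaHom W p k r Ψ w₀ F g hg y := by
  apply Ψ.injective
  funext w
  rw [map_smul_apply_of_tmul p k r Ψ hΨ, apply_definedLambdaHom, apply_definedLambdaHom,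
    map_smul, hF, map_mul,
    galAdicCompletionMap_algebraMap_adicCompletion _ _ w₀ w (inv_smul_eq_of_smul_eq (hg w))]

/-- **Kato's value datum `Λ_{k,r} : H¹(U, T_pW) →ₗ[ℤ_p] ℚ_p ⊗ ℚ(ζ_m)` DEFINED through one completion** — the
`ℤ_p`-linear map underlying `definedLambdaHom` (EXACTLY the type of the `Λ k r` of `Kato2004.ZetaBody`), for an
abstract additive `F` with the semilinearity `hF` (discharged for `F = exp*_{w₀} ∘ loc^{tower}_{w₀} ∘ H1toInt`
by `expStarTowerMap_smul`, §2). [cite: Kato2004Asterisque, §9.4 (p. 188)]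
[cite: CasselsFrohlichANT1967, Ch. II §10 Theorem (10.2) and Ch. VII §1.1] -/
def definedLambda :
    H1 (tateRep W p) (cycSubgroup p k r) →ₗ[ℤ_[p]] ℚ_[p] ⊗[ℚ] CyclotomicField (cycLevel p k r) ℚ where
  toFun := definedLambdaHom W p k r Ψ w₀ F g hg
  map_add' := map_add _
  map_smul' a y := definedLambdaHom_smul W p k r Ψ w₀ F g hg hΨ hF a y

/-- `definedLambda` is `definedLambdaHom` as a function. [cite: Kato2004Asterisque, §9.4 (p. 188)] -/
@[simp] theorem definedLambda_apply (y : H1 (tateRep W p) (cycSubgroup p k r)) :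
    definedLambda W p k r Ψ w₀ F g hg hΨ hF y = definedLambdaHom W p k r Ψ w₀ F g hg y := rfl

/-- **(DEF₀) at class level for `definedLambda`**: `Ψ (Λ y)_w = (g̃_w⁻¹)_* (F (g_w · y))`.
[cite: Kato2004Asterisque, §9.4 (p. 188)] -/
theorem apply_definedLambda (y : H1 (tateRep W p) (cycSubgroup p k r))
    (w : ((Rat.HeightOneSpectrum.primesEquiv (R := 𝓞 ℚ)).symm ⟨p, Fact.out⟩).Extension
      (𝓞 (CyclotomicField (cycLevel p k r) ℚ))) :
    Ψ (definedLambda W p k r Ψ w₀ F g hg hΨ hF y) w = galAdicCompletionMap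
      (sigma (cycLevel p k r) (modNCyclotomicCharacter ℚ (cycLevel p k r) (g w)))⁻¹
      (inv_smul_eq_of_smul_eq (hg w))
      (F (conjMap (tateRep W p).toTopRep (cycSubgroup p k r) (g w) 1 y)) :=
  apply_definedLambdaHom W p k r Ψ w₀ F g hg y w

end Abstract

/-! ### §2 Plumbing at the completions `L_w`, `w ∣ p` (every `p`) -/

section Plumbing

variable (p : ℕ) [hp : Fact p.Prime] (k : ℕ) (r : Finset (HeightOneSpectrum (𝓞 ℚ)))

/-- **`p ∈ w`** for a place `w` of `ℚ(ζ_m)` above the base place `v_p = primesEquiv.symm p` (kim3 g14's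
`three_mem_asIdeal_extension` at every `p`): keys the `ℚ_p`-algebra / `|p|_w < 1` structures of `L_w`. [folklore] -/
theorem prime_mem_asIdeal_extension (m : ℕ)
    (w : ((Rat.HeightOneSpectrum.primesEquiv (R := 𝓞 ℚ)).symm ⟨p, Fact.out⟩).Extension
      (𝓞 (CyclotomicField m ℚ))) :
    ((p : ℕ) : 𝓞 (CyclotomicField m ℚ)) ∈ w.1.asIdeal := by
  have h0 : ((p : ℕ) : 𝓞 ℚ) ∈ ((Rat.HeightOneSpectrum.primesEquiv (R := 𝓞 ℚ)).symm ⟨p, Fact.out⟩).asIdeal :=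
    (natCast_mem_asIdeal_iff_eq_primesEquiv_symm _ hp.out).mpr rfl
  have h1 := w.2
  rw [HeightOneSpectrum.ext_iff] at h1
  rw [← h1] at h0
  change ((p : ℕ) : 𝓞 ℚ) ∈ Ideal.comap (algebraMap (𝓞 ℚ) (𝓞 (CyclotomicField m ℚ))) w.1.asIdeal at h0
  rw [Ideal.mem_comap, map_natCast] at h0
  exact h0

set_option backward.isDefEq.respectTransparency false in
/-- **The tower restriction `Γ_{L_w} → Γ_{ℚ_{v_p}} → Γ_ℚ` of a completion `L_w` (`w ∣ p`) of `L = ℚ(ζ_m)`,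
`m = cycLevel p k r`, lands in the level `cycSubgroup p k r`** (kim3's
`absGaloisRestrictTower_adicCompletion_mem_cycSubgroup_level` at every `p`: `L_w ∋ ζ_m`, so w2-acc5's
`absGaloisRestrictTower_mem_cycSubgroup` applies). [cite: Rubin2000, Ch. III §2.1] -/
theorem absGaloisRestrictTower_adicCompletion_mem_cycSubgroup_prime
    (w : (((Rat.HeightOneSpectrum.primesEquiv (R := 𝓞 ℚ)).symm ⟨p, Fact.out⟩).Extension
      (𝓞 (CyclotomicField (cycLevel p k r) ℚ))))
    (σ : absoluteGaloisGroup (w.1.adicCompletion (CyclotomicField (cycLevel p k r) ℚ))) :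
    absGaloisRestrictTower ℚ (((Rat.HeightOneSpectrum.primesEquiv (R := 𝓞 ℚ)).symm ⟨p, Fact.out⟩).adicCompletion ℚ)
      (w.1.adicCompletion (CyclotomicField (cycLevel p k r) ℚ)) σ ∈ cycSubgroup p k r := by
  have hcomp : algebraMap ℚ (w.1.adicCompletion (CyclotomicField (cycLevel p k r) ℚ)) =
      (algebraMap (((Rat.HeightOneSpectrum.primesEquiv (R := 𝓞 ℚ)).symm ⟨p, Fact.out⟩).adicCompletion ℚ)
        (w.1.adicCompletion (CyclotomicField (cycLevel p k r) ℚ))).comp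
        (algebraMap ℚ (((Rat.HeightOneSpectrum.primesEquiv (R := 𝓞 ℚ)).symm ⟨p, Fact.out⟩).adicCompletion ℚ)) :=
    Subsingleton.elim _ _
  haveI hST : IsScalarTower ℚ (((Rat.HeightOneSpectrum.primesEquiv (R := 𝓞 ℚ)).symm ⟨p, Fact.out⟩).adicCompletion ℚ)
      (w.1.adicCompletion (CyclotomicField (cycLevel p k r) ℚ)) := IsScalarTower.of_algebraMap_eq' hcomp
  have hζ := ((IsCyclotomicExtension.zeta_spec (cycLevel p k r) ℚ
      (CyclotomicField (cycLevel p k r) ℚ)).map_of_injective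
    (algebraMap (CyclotomicField (cycLevel p k r) ℚ)
      (w.1.adicCompletion (CyclotomicField (cycLevel p k r) ℚ))).injective)
  exact absGaloisRestrictTower_mem_cycSubgroup p k r _ _ hζ σ

/-- **The canonical `ℚ_p`-structure of `L_w` reads `ℚ_p` through `ℚ_{v_p}`**: for `w ∣ p`,
`algebraMap ℚ_p L_w = (ℚ_{v_p} → L_w) ∘ e_p` with `e_p = Padic.adicCompletionEquiv` (both are continuous ring
homomorphisms `ℚ_p → L_w`; there is exactly one, `LocalField.eq_algebraMap_adicCompletionPadicAlgebra`; cf.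
w2-kport `KPort.algebraMap_adicCompletionPadicAlgebra_eq`). [cite: SerreLocalFields1979, Ch. II §3] -/
theorem algebraMap_adicCompletionPadicAlgebra_eq_algebraMap_adicCompletionEquiv (m : ℕ)
    (w : ((Rat.HeightOneSpectrum.primesEquiv (R := 𝓞 ℚ)).symm ⟨p, Fact.out⟩).Extension
      (𝓞 (CyclotomicField m ℚ))) (hw : ((p : ℕ) : 𝓞 (CyclotomicField m ℚ)) ∈ w.1.asIdeal) (a : ℚ_[p]) :
    (letI := LocalField.adicCompletionPadicAlgebra w.1 p hw
     algebraMap ℚ_[p] (w.1.adicCompletion (CyclotomicField m ℚ)) a) =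
      algebraMap (((Rat.HeightOneSpectrum.primesEquiv (R := 𝓞 ℚ)).symm ⟨p, Fact.out⟩).adicCompletion ℚ)
        (w.1.adicCompletion (CyclotomicField m ℚ)) (Padic.adicCompletionEquiv (𝓞 ℚ) ⟨p, Fact.out⟩ a) := by
  have hcont : Continuous ((algebraMap (((Rat.HeightOneSpectrum.primesEquiv (R := 𝓞 ℚ)).symm ⟨p, Fact.out⟩).adicCompletion ℚ)
      (w.1.adicCompletion (CyclotomicField m ℚ))).comp
        (Padic.adicCompletionEquiv (𝓞 ℚ) ⟨p, Fact.out⟩).toRingHom) :=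
    (continuous_algebraMap _ _).comp (Padic.adicCompletionEquiv (𝓞 ℚ) ⟨p, Fact.out⟩).continuous
  have h := LocalField.eq_algebraMap_adicCompletionPadicAlgebra w.1 p hw _ hcont
  exact (RingHom.congr_fun h a).symm

end Plumbing

end Summit.BirchSwinnertonDyer.BirchSwinnertonDyer.Theorems.KimAtThreeFineKatoDefinedLambda

end
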